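import Summits.HodgeConjecture.HodgeConjecture.Theses.EndoscopicMiddleDegree
import Literature.AlgebraicGeometry.HodgeTheory.GysinBaseChange
import Literature.AlgebraicGeometry.HodgeTheory.ComplexGysinCorrespondence

/-!
# Stub `stub_corrAlgebra` (line `impure-barren-envelope` of crux
# `EndoscopicMiddleDegree.OrthogonalEnveloped`, stmt-HodgeConjecture-14300): the actions of
# algebraic self-correspondences contain the identity and are closed under composition

Registered skeleton: line `IdeatorThreeSketch` of crux `OrthogonalEnveloped`; this is the file
`Theorems/EndoscopicMiddleDegreeOrthogonalEnvelopedCorrAlgebra.lean` of the summit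
(`--supports stmt-HodgeConjecture-14300`).

WHAT IS PROVED. For an orientation family `μ` with Poincaré duality and `X` smooth projective
over `ℂ` of dimension `n`, write `P_γ = corrAction μ hX hX rfl γ : Hᵃ(X(ℂ); ℂ) →ₗ Hᵃ(X(ℂ); ℂ)`,
`P_γ β = pr₁₊(pr₂^* β ∪ γ)`, for the action of a class `γ ∈ H²ⁿ((X ⊗ X)(ℂ); ℂ)` as a
self-correspondence (Fulton, *Intersection Theory*, §16.1).
* `corrAction_gysinDiagonal_one` — **the diagonal acts as the identity**: `P_{Δ₊ 1} = id` for
  the diagonal `Δ = lift (𝟙 X) (𝟙 X) : X ⟶ X ⊗ X` (projection formula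
  `pr₂^* β ∪ Δ₊ 1 = Δ₊(Δ^* pr₂^* β ∪ 1)`, functoriality `pr₁₊ Δ₊ = (Δ ≫ pr₁)₊ = id`,
  `Δ^* pr₂^* = id`), and `gysinDiagonal_one_mem_algebraicClasses`:
  `Δ₊ 1 ∈ Nⁿ H²ⁿ((X ⊗ X)(ℂ))` is algebraic (Gysin images of algebraic classes are algebraic).
* `exists_algebraic_corrAction_comp` — **closed under composition**: for algebraic
  `γ, γ' ∈ Nⁿ H²ⁿ((X ⊗ X)(ℂ))` the class `γ'' = c • p₁₃₊(p₁₂^* γ ∪ p₂₃^* γ')` is algebraic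
  (`corrCompClass_mem_algebraicClasses`, GRANTED the cup-multiplicativity `Nⁿ ∪ Nⁿ ⊆ N²ⁿ` of
  algebraic classes on `X ⊗ (X ⊗ X)`, hypothesis `hCUP`, Voisin II Prop. 9.20) and
  `P_{γ''} = P_γ ∘ P_{γ'}` (`corr_comp_of_baseChange` fed with the proved Gysin base change
  `gysin_baseChange`, which supplies `c`).
* `stub_corrAlgebra` — the registered stub: both facts at `n = a = 2(m+1)`.
Pattern of `corrComp_surfaces_of_cup` (`HodgeTheory/GysinBaseChange`) with `2 ↦ 2(m+1)`, plus
the unit. Sources: Fulton, Intersection Theory §16.1 Prop. 16.1.1 / Def. 16.1.2 (correspondences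
form a ring acting on cohomology, the diagonal being the unit); Voisin II Prop. 9.20 for `hCUP`.
-/

noncomputable section

-- The crux-workfile namespace `Summit.<P>.<Sub>.Cruxes.…` repeats `HodgeConjecture` (single-conjunct summit).
set_option linter.dupNamespace false

namespace Summit.HodgeConjecture.HodgeConjecture.Cruxes.OrthogonalEnveloped.ImpureBarrenEnvelope

open scoped BigOperators
open CategoryTheory MonoidalCategory CartesianMonoidalCategory
open Literature.AlgebraicGeometry.Motives (SchemeOver ComplexPoints IsSmoothProjective)
open Literature.AlgebraicGeometry.Motives (IsSmoothProjective.tensor_holds)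
open Literature.AlgebraicGeometry.HodgeTheory
open Literature.AlgebraicGeometry.ShimuraVarieties
open Literature.AlgebraicTopology.SingularHomology

/-! ## Helper lemmas (worker): the unit and the composition of algebraic self-correspondences -/

/-- **The diagonal class is algebraic**: for `X` smooth projective of dimension `n` and the
diagonal `Δ = lift (𝟙 X) (𝟙 X) : X ⟶ X ⊗ X`, the Gysin image `Δ₊ 1 ∈ H²ⁿ((X ⊗ X)(ℂ); ℂ)` of
`1 ∈ H⁰(X(ℂ); ℂ) = N⁰ H⁰` lies in `Nⁿ H²ⁿ = algebraicClasses (X ⊗ X) n` (proper push-forward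
shifts the support filtration by the relative dimension, `complexGysin_mem_supportedClasses` with
the proved support property `gysinMap_restrictCompl_eq_zero_of_field ℂ`).
[cite: FultonYoungTableaux1997, Appendix B §B.2 Exercise 5 and §B.3] -/
theorem gysinDiagonal_one_mem_algebraicClasses (μ : OrientationFamily) (hμ : μ.HasPoincareDuality)
    {n : ℕ} {X : SchemeOver ℂ} (hX : IsSmoothProjective n X) :
    complexGysin μ hX (IsSmoothProjective.tensor_holds hX hX) (lift (𝟙 X) (𝟙 X))
        (show 0 + 2 * (n + n) = 2 * n + 2 * n by omega)
        (singularCohomology.one ℂ (ComplexPoints X)) ∈ algebraicClasses (X ⊗ X) n :=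
  complexGysin_mem_supportedClasses (gysinMap_restrictCompl_eq_zero_of_field ℂ) μ hμ hX
    (IsSmoothProjective.tensor_holds hX hX) (lift (𝟙 X) (𝟙 X)) _ (r := 0) (by omega)
    (by rw [supportedClasses_zero]; exact Submodule.mem_top)

/-- **The diagonal acts as the identity correspondence** (Fulton §16.1: `[Δ]` is the unit of the
ring of correspondences and acts as the identity): `P_{Δ₊ 1} β = pr₁₊(pr₂^* β ∪ Δ₊ 1) = β` on
`Hᵃ(X(ℂ); ℂ)`. Proof: the projection formula for `Δ` read right to left,
`pr₂^* β ∪ Δ₊ 1 = Δ₊(Δ^* pr₂^* β ∪ 1)` (`complexGysin_cup`), `∪ 1 = id` (`cupProduct_one`),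
`Δ^* pr₂^* = (Δ ≫ pr₂)^* = id` and `pr₁₊ Δ₊ = (Δ ≫ pr₁)₊ = (𝟙 X)₊ = id` (`complexGysin_comp`,
`complexGysin_id`). [cite: Fulton1998, §16.1 Prop. 16.1.1 and Def. 16.1.2] -/
theorem corrAction_gysinDiagonal_one {μ : OrientationFamily} (hμ : μ.HasPoincareDuality)
    {n : ℕ} {X : SchemeOver ℂ} (hX : IsSmoothProjective n X) (a : ℕ) :
    corrAction μ hX hX (rfl : a + 2 * n = a + 2 * n)
        (complexGysin μ hX (IsSmoothProjective.tensor_holds hX hX) (lift (𝟙 X) (𝟙 X))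
          (show 0 + 2 * (n + n) = 2 * n + 2 * n by omega)
          (singularCohomology.one ℂ (ComplexPoints X))) =
      LinearMap.id := by
  have hXX := IsSmoothProjective.tensor_holds hX hX
  refine LinearMap.ext fun β => ?_
  rw [corrAction_apply, LinearMap.id_apply,
    ← complexGysin_cup hμ hX hXX (lift (𝟙 X) (𝟙 X)) (Nat.add_zero a)
      (show a + 2 * (n + n) = a + 2 * n + 2 * n by omega)
      (show 0 + 2 * (n + n) = 2 * n + 2 * n by omega) rfl
      (complexBetti.map (snd X X) a β) (singularCohomology.one ℂ (ComplexPoints X)),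
    cupProduct_one, ← CategoryTheory.comp_apply, ← complexBetti.map_comp, lift_snd,
    complexBetti.map_id, CategoryTheory.id_apply,
    ← LinearMap.comp_apply (f := complexGysin μ hXX hX (fst X X) _),
    ← complexGysin_comp hμ hX hXX hX (lift (𝟙 X) (𝟙 X)) (fst X X)]
  simp only [lift_fst]
  rw [complexGysin_id hμ hX a, LinearMap.id_apply]

/-- **The actions of algebraic self-correspondences are closed under composition** (Fulton
Prop. 16.1.1 (a) with Buskin's Lemma 6.3): for `μ` with Poincaré duality, `X` smooth projective
of dimension `n` and algebraic `γ, γ' ∈ Nⁿ H²ⁿ((X ⊗ X)(ℂ); ℂ)`, there is an algebraic `γ''` with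
`P_{γ''} = P_γ ∘ P_{γ'}` on `Hᵃ(X(ℂ); ℂ)`, namely `γ'' = c • p₁₃₊(p₁₂^* γ ∪ p₂₃^* γ')`
(`corr_comp_of_baseChange` with the Gysin base change `gysin_baseChange`, which supplies the
scalar `c`; algebraic by `corrCompClass_mem_algebraicClasses`), GRANTED the multiplicativity
`Nⁿ ∪ Nⁿ ⊆ N²ⁿ` of algebraic classes on `X ⊗ (X ⊗ X)` (`hCUP`, Voisin II Prop. 9.20).
[cite: Fulton1998, §16.1 Prop. 16.1.1 and Def. 16.1.2] [cite: Buskin2019, Lemma 6.3]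
[cite: VoisinHodgeII2003, §9.2.4 Prop. 9.20] -/
theorem exists_algebraic_corrAction_comp {μ : OrientationFamily} (hμ : μ.HasPoincareDuality)
    {n : ℕ} {X : SchemeOver ℂ} (hX : IsSmoothProjective n X)
    (hCUP : ∀ a ∈ algebraicClasses (X ⊗ (X ⊗ X)) n, ∀ b ∈ algebraicClasses (X ⊗ (X ⊗ X)) n,
      cupProduct ((Nat.mul_add 2 n n).symm : 2 * n + 2 * n = 2 * (n + n)) a b ∈
        algebraicClasses (X ⊗ (X ⊗ X)) (n + n))
    (a : ℕ) {γ : complexBetti (X ⊗ X) (2 * n)} (hγ : γ ∈ algebraicClasses (X ⊗ X) n)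
    {γ' : complexBetti (X ⊗ X) (2 * n)} (hγ' : γ' ∈ algebraicClasses (X ⊗ X) n) :
    ∃ γ'' ∈ algebraicClasses (X ⊗ X) n,
      corrAction μ hX hX (rfl : a + 2 * n = a + 2 * n) γ'' =
        corrAction μ hX hX (rfl : a + 2 * n = a + 2 * n) γ ∘ₗ
          corrAction μ hX hX (rfl : a + 2 * n = a + 2 * n) γ' := by
  obtain ⟨c, hc⟩ := gysin_baseChange μ hX hX hX (show a + 2 * n + 2 * n = a + 2 * (n + n) by omega)
  refine ⟨c • complexGysin μ
      (IsSmoothProjective.tensor_holds hX (IsSmoothProjective.tensor_holds hX hX))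
      (IsSmoothProjective.tensor_holds hX hX) (X ◁ snd X X)
      (show 2 * (n + n) + 2 * (n + n) = 2 * n + 2 * (n + (n + n)) by omega)
      (cupProduct ((Nat.mul_add 2 n n).symm : 2 * n + 2 * n = 2 * (n + n))
        (complexBetti.map (X ◁ fst X X) (2 * n) γ) (complexBetti.map (snd X (X ⊗ X)) (2 * n) γ')),
    Submodule.smul_mem _ c (corrCompClass_mem_algebraicClasses hμ hX hX hX (e := n) (e' := n)
      (e'' := n) rfl hCUP hγ hγ'), LinearMap.ext fun y => ?_⟩
  rw [LinearMap.comp_apply, corrAction_apply, corrAction_apply, corrAction_apply]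
  exact corr_comp_of_baseChange hμ hX hX hX (e := n) (j := 2 * n) (k := 2 * n) (d := 2 * (n + n))
    (a := a) (a₁ := a) (a₂ := a) rfl rfl rfl ((Nat.mul_add 2 n n).symm) γ γ' c hc y

/-! ## The registered stub (signature must stay BYTE-IDENTICAL) -/

/-- **Stub 3 — the actions of algebraic self-correspondences form an algebra (KNOWN: Fulton
§16.1 Prop. 16.1.1 / Def. 16.1.2; provable now in the tree).** For `μ` with Poincaré duality and
`X` smooth projective of dimension `2(m+1)`, GRANTED the cup-multiplicativity of Stub 2 on
`X ⊗ (X ⊗ X)`: (i) `P_δ = id` for some algebraic `δ` (the diagonal `Δ_* 1`, by the projection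
formula `complexGysin_cup`, `complexGysin_comp`, `complexGysin_id`, algebraic since Gysin images
of algebraic classes are algebraic — `corrAction_gysinDiagonal_one`,
`gysinDiagonal_one_mem_algebraicClasses`); (ii) for algebraic `γ, γ'` there is an algebraic `γ''`
with `P_{γ''} = P_γ ∘ P_{γ'}` (`γ'' = c • p₁₃₊(p₁₂^* γ ∪ p₂₃^* γ')`: `corr_comp_of_baseChange`
with the proved `gysin_baseChange`, algebraic by `corrCompClass_mem_algebraicClasses` —
`exists_algebraic_corrAction_comp`). [cite: Fulton1998, §16.1 Prop. 16.1.1 and Def. 16.1.2]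
[cite: VoisinHodgeII2003, §9.2.4 Prop. 9.20] -/
theorem stub_corrAlgebra :
    ∀ (μ : OrientationFamily), μ.HasPoincareDuality →
      ∀ (m : ℕ) (X : SchemeOver ℂ) (hX : IsSmoothProjective (2 * (m + 1)) X),
        (∀ a ∈ algebraicClasses (X ⊗ (X ⊗ X)) (2 * (m + 1)),
          ∀ b ∈ algebraicClasses (X ⊗ (X ⊗ X)) (2 * (m + 1)),
            cupProduct ((Nat.mul_add 2 (2 * (m + 1)) (2 * (m + 1))).symm :
                2 * (2 * (m + 1)) + 2 * (2 * (m + 1)) = 2 * (2 * (m + 1) + 2 * (m + 1))) a b ∈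
              algebraicClasses (X ⊗ (X ⊗ X)) (2 * (m + 1) + 2 * (m + 1))) →
        (∃ δ ∈ algebraicClasses (X ⊗ X) (2 * (m + 1)),
            corrAction μ hX hX
                (rfl : 2 * (m + 1) + 2 * (2 * (m + 1)) = 2 * (m + 1) + 2 * (2 * (m + 1))) δ =
              LinearMap.id) ∧
        (∀ γ ∈ algebraicClasses (X ⊗ X) (2 * (m + 1)), ∀ γ' ∈ algebraicClasses (X ⊗ X) (2 * (m + 1)),
            ∃ γ'' ∈ algebraicClasses (X ⊗ X) (2 * (m + 1)),
              corrAction μ hX hX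
                  (rfl : 2 * (m + 1) + 2 * (2 * (m + 1)) = 2 * (m + 1) + 2 * (2 * (m + 1))) γ'' =
                corrAction μ hX hX
                    (rfl : 2 * (m + 1) + 2 * (2 * (m + 1)) = 2 * (m + 1) + 2 * (2 * (m + 1))) γ ∘ₗ
                  corrAction μ hX hX
                    (rfl : 2 * (m + 1) + 2 * (2 * (m + 1)) = 2 * (m + 1) + 2 * (2 * (m + 1))) γ') := by
  intro μ hμ m X hX hCUP
  exact ⟨⟨_, gysinDiagonal_one_mem_algebraicClasses μ hμ hX,
      corrAction_gysinDiagonal_one hμ hX (2 * (m + 1))⟩,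
    fun γ hγ γ' hγ' => exists_algebraic_corrAction_comp hμ hX hCUP (2 * (m + 1)) hγ hγ'⟩

end Summit.HodgeConjecture.HodgeConjecture.Cruxes.OrthogonalEnveloped.ImpureBarrenEnvelope

end
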